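import Mathlib
import Literature.NumberTheory.Transcendental.KZHyperbolicLadder
import Summits.KontsevichZagierPeriods.KontsevichZagierPeriods.Theorems.HyperbolicBlochOffTetraSectorKernelStubSimilarityMove

/-!
# Stub `isGeodesicPolytope_image_boundarySimilarity`
# (crux `OffTetraSectorKernel`, line `odd-hyperbolic-ladder`)

The scissors relators of Goncharov's hyperbolic ladder list the `ℚ̄`-Möbius congruences of rung `n`
(the upper half-space model `ℝⁿ × ℝ₊` of `ℍⁿ⁺¹`, coordinates `p : Fin (n + 1) → ℝ`, boundary point
`x = Fin.init p`, height `t = p (Fin.last n)`) by GENERATORS, and require both `P` and `g '' P` to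
be `ℚ̄`-geodesic polytopes. For the boundary similarities `g : (x, t) ↦ (c • A x + b, c t)`
(`c > 0`, `Aᵀ A = 1`, `c, A, b` real algebraic) the second requirement is automatic, and this file
proves it: the image of a finite-volume `ℚ̄`-geodesic polytope under `g` is again one.

* `g` maps the open geodesic half-spaces onto open geodesic half-spaces, with EXPLICIT new data:
  a vertical half-space `ε (Σ aₗ pₗ − c₀) > 0` (normal `a = (a_x, 0)`) goes to the vertical
  half-space with normal `(c • A a_x, 0)` and level `c² c₀ + c ⟨A a_x, b⟩`, and a hemisphere
  `ε (Σ (pₗ − aₗ)² − c₀) > 0` centred at the boundary point `(a_x, 0)` goes to the hemisphere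
  centred at `g (a_x, 0) = (c • A a_x + b, 0)` with squared radius `c² c₀`; in both cases the new
  defining expression at `g p` is `c²` times the old one at `p` (`A` preserves dot products).
* the new data are real algebraic (sums and products of algebraic reals);
* `g` is a bijection of `ℝⁿ⁺¹` (inverse `(y, s) ↦ (c⁻¹ • Aᵀ (y − b), c⁻¹ s)`, using `A Aᵀ = 1`),
  which gives the set equality;
* the hyperbolic volume stays finite: by the change-of-variables criterion
  `MeasureTheory.integrableOn_image_iff_integrableOn_abs_det_fderiv_smul` (the polytope is open,
  hence measurable; `g` is injective and affine with linear part `L`, `|det L| = c^{n+1}`), the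
  pulled-back density `|det L| · (c t)^{-(n+1)}` is `t^{-(n+1)}` itself.

References: R. Benedetti, C. Petronio, *Lectures on Hyperbolic Geometry* (1992), A.3.5;
A. B. Goncharov, *Volumes of hyperbolic manifolds and mixed Tate motives* (1999), §1.1;
J. L. Dupont, C.-H. Sah, *Scissors congruences II* (1982), §2.
-/

noncomputable section

open Set MeasureTheory
open Literature.NumberTheory.Transcendental

namespace Summit.KontsevichZagierPeriods.HyperbolicBloch.OffTetraSectorKernel

/-! ### Algebraicity bookkeeping -/

/-- A finite sum of real algebraic numbers is algebraic. [folklore] -/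
theorem polySimil_isAlgebraic_sum {ι : Type*} (s : Finset ι) (f : ι → ℝ)
    (hf : ∀ i ∈ s, IsAlgebraic ℚ (f i)) : IsAlgebraic ℚ (∑ i ∈ s, f i) :=
  Finset.sum_induction f (IsAlgebraic ℚ) (fun _ _ ha hb => ha.add hb) isAlgebraic_zero hf

/-- The dot product of two vectors with real-algebraic entries is algebraic. [folklore] -/
theorem polySimil_isAlgebraic_dotProduct {n : ℕ} {v w : Fin n → ℝ}
    (hv : ∀ j, IsAlgebraic ℚ (v j)) (hw : ∀ j, IsAlgebraic ℚ (w j)) :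
    IsAlgebraic ℚ (v ⬝ᵥ w) :=
  polySimil_isAlgebraic_sum _ _ fun j _ => (hv j).mul (hw j)

/-- The entries of `A *ᵥ w` are algebraic when those of `A` and `w` are. [folklore] -/
theorem polySimil_isAlgebraic_mulVec {n : ℕ} {A : Matrix (Fin n) (Fin n) ℝ} {w : Fin n → ℝ}
    (hA : ∀ i j, IsAlgebraic ℚ (A i j)) (hw : ∀ j, IsAlgebraic ℚ (w j)) (i : Fin n) :
    IsAlgebraic ℚ (A.mulVec w i) :=
  polySimil_isAlgebraic_dotProduct (hA i) hw

/-! ### The boundary similarity: coordinates, orthogonality, inverse -/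

/-- An orthogonal matrix (`Aᵀ A = 1`) preserves dot products: `⟨A u, A w⟩ = ⟨u, w⟩`. [folklore] -/
theorem polySimil_dotProduct_mulVec_mulVec {n : ℕ} {A : Matrix (Fin n) (Fin n) ℝ}
    (hA : A.transpose * A = 1) (u w : Fin n → ℝ) :
    A.mulVec u ⬝ᵥ A.mulVec w = u ⬝ᵥ w := by
  rw [Matrix.dotProduct_mulVec, Matrix.vecMul_mulVec, hA, Matrix.vecMul_one]

/-- The height coordinate of the boundary similarity: `(g p) (last) = c t`. [folklore] -/
@[simp] theorem polySimil_apply_last (n : ℕ) (c : ℝ) (A : Matrix (Fin n) (Fin n) ℝ)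
    (b : Fin n → ℝ) (p : Fin (n + 1) → ℝ) :
    KZ.boundarySimilarity n c A b p (Fin.last n) = c * p (Fin.last n) := by
  simp [KZ.boundarySimilarity]

/-- The boundary coordinates of the boundary similarity: `(g p) j = (c • A x + b) j`. [folklore] -/
@[simp] theorem polySimil_apply_castSucc (n : ℕ) (c : ℝ) (A : Matrix (Fin n) (Fin n) ℝ)
    (b : Fin n → ℝ) (p : Fin (n + 1) → ℝ) (j : Fin n) :
    KZ.boundarySimilarity n c A b p (Fin.castSucc j) = (c • A.mulVec (Fin.init p) + b) j := by
  simp [KZ.boundarySimilarity]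

/-- The boundary similarity is onto: `g (c⁻¹ • Aᵀ (y − b), c⁻¹ s) = (y, s)` (`A Aᵀ = 1` follows
from `Aᵀ A = 1` for square matrices). [folklore] -/
theorem polySimil_apply_symm_apply {n : ℕ} {c : ℝ} {A : Matrix (Fin n) (Fin n) ℝ} (b : Fin n → ℝ)
    (hc : c ≠ 0) (hA : A.transpose * A = 1) (q : Fin (n + 1) → ℝ) :
    KZ.boundarySimilarity n c A b (Fin.snoc (α := fun _ => ℝ)
      (c⁻¹ • A.transpose.mulVec (Fin.init q - b)) (c⁻¹ * q (Fin.last n))) = q := by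
  have hA' : A * A.transpose = 1 := mul_eq_one_comm.mp hA
  unfold KZ.boundarySimilarity
  rw [Fin.init_snoc, Fin.snoc_last, Matrix.mulVec_smul, smul_smul, mul_inv_cancel₀ hc, one_smul,
    Matrix.mulVec_mulVec, hA', Matrix.one_mulVec, sub_add_cancel, ← mul_assoc,
    mul_inv_cancel₀ hc, one_mul, Fin.snoc_init_self]

/-! ### Transformation of the two kinds of constraints -/

/-- A VERTICAL half-space is mapped to a vertical half-space: for a normal `a = (a_x, 0)`,
`Σₗ (c • A a_x, 0)ₗ (g p)ₗ = c² Σₗ aₗ pₗ + c ⟨A a_x, b⟩`. [cite: BenedettiPetronio1992, A.3.5] -/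
theorem polySimil_sum_flat {n : ℕ} {c : ℝ} {A : Matrix (Fin n) (Fin n) ℝ} (b : Fin n → ℝ)
    (hA : A.transpose * A = 1) {a : Fin (n + 1) → ℝ} (ha : a (Fin.last n) = 0)
    (p : Fin (n + 1) → ℝ) :
    ∑ l, (Fin.snoc (α := fun _ => ℝ) (c • A.mulVec (Fin.init a)) 0 : Fin (n + 1) → ℝ) l *
        KZ.boundarySimilarity n c A b p l =
      c ^ 2 * ∑ l, a l * p l + c * (A.mulVec (Fin.init a) ⬝ᵥ b) := by
  have hR : ∑ l, a l * p l = Fin.init a ⬝ᵥ Fin.init p := by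
    rw [Fin.sum_univ_castSucc, ha, zero_mul, add_zero]
    rfl
  rw [Fin.sum_univ_castSucc, hR]
  simp only [Fin.snoc_castSucc, Fin.snoc_last, zero_mul, add_zero, polySimil_apply_castSucc]
  change (c • A.mulVec (Fin.init a)) ⬝ᵥ (c • A.mulVec (Fin.init p) + b) = _
  rw [dotProduct_add, dotProduct_smul, smul_dotProduct, smul_dotProduct,
    polySimil_dotProduct_mulVec_mulVec hA]
  simp only [smul_eq_mul]
  ring

/-- A HEMISPHERE centred on the boundary is mapped to a hemisphere centred on the boundary: for a
centre `a = (a_x, 0)`, `Σₗ ((g p)ₗ − (c • A a_x + b, 0)ₗ)² = c² Σₗ (pₗ − aₗ)²` (`A` is an isometry).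
[cite: BenedettiPetronio1992, A.3.5] -/
theorem polySimil_sum_round {n : ℕ} {c : ℝ} {A : Matrix (Fin n) (Fin n) ℝ} (b : Fin n → ℝ)
    (hA : A.transpose * A = 1) {a : Fin (n + 1) → ℝ} (ha : a (Fin.last n) = 0)
    (p : Fin (n + 1) → ℝ) :
    ∑ l, (KZ.boundarySimilarity n c A b p l -
        (Fin.snoc (α := fun _ => ℝ) (c • A.mulVec (Fin.init a) + b) 0 : Fin (n + 1) → ℝ) l) ^ 2 =
      c ^ 2 * ∑ l, (p l - a l) ^ 2 := by
  have hR : ∑ l, (p l - a l) ^ 2 =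
      (Fin.init p - Fin.init a) ⬝ᵥ (Fin.init p - Fin.init a) + p (Fin.last n) ^ 2 := by
    rw [Fin.sum_univ_castSucc, ha, sub_zero]
    congr 1
    simp only [dotProduct, Pi.sub_apply, sq]
    rfl
  have hL : ∀ j : Fin n, KZ.boundarySimilarity n c A b p (Fin.castSucc j) -
      (Fin.snoc (α := fun _ => ℝ) (c • A.mulVec (Fin.init a) + b) 0 : Fin (n + 1) → ℝ)
        (Fin.castSucc j) = (c • A.mulVec (Fin.init p - Fin.init a)) j := by
    intro j
    simp only [polySimil_apply_castSucc, Fin.snoc_castSucc, Pi.add_apply, Pi.smul_apply,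
      smul_eq_mul, Matrix.mulVec_sub, Pi.sub_apply]
    ring
  rw [Fin.sum_univ_castSucc, hR]
  simp only [hL, Fin.snoc_last, polySimil_apply_last, sub_zero]
  have h2 : ∑ j, (c • A.mulVec (Fin.init p - Fin.init a)) j ^ 2 =
      (c • A.mulVec (Fin.init p - Fin.init a)) ⬝ᵥ (c • A.mulVec (Fin.init p - Fin.init a)) := by
    simp only [dotProduct, sq]
  rw [h2, smul_dotProduct, dotProduct_smul, polySimil_dotProduct_mulVec_mulVec hA]
  simp only [smul_eq_mul]
  ring

/-- The defining expression of the image half-space at `g p` is `c²` times the defining expression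
of the original half-space at `p` (both kinds at once, the kind selected by `flat`).
[cite: BenedettiPetronio1992, A.3.5] -/
theorem polySimil_constraint_apply {n : ℕ} {c : ℝ} {A : Matrix (Fin n) (Fin n) ℝ} (b : Fin n → ℝ)
    (hA : A.transpose * A = 1) (flat : Bool) {a : Fin (n + 1) → ℝ} (ha : a (Fin.last n) = 0)
    (c₀ : ℝ) (p : Fin (n + 1) → ℝ) :
    (if flat then
        (∑ l, (Fin.snoc (α := fun _ => ℝ)
          (if flat then c • A.mulVec (Fin.init a) else c • A.mulVec (Fin.init a) + b) 0 :
            Fin (n + 1) → ℝ) l * KZ.boundarySimilarity n c A b p l) -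
          (if flat then c ^ 2 * c₀ + c * (A.mulVec (Fin.init a) ⬝ᵥ b) else c ^ 2 * c₀)
      else
        (∑ l, (KZ.boundarySimilarity n c A b p l - (Fin.snoc (α := fun _ => ℝ)
          (if flat then c • A.mulVec (Fin.init a) else c • A.mulVec (Fin.init a) + b) 0 :
            Fin (n + 1) → ℝ) l) ^ 2) -
          (if flat then c ^ 2 * c₀ + c * (A.mulVec (Fin.init a) ⬝ᵥ b) else c ^ 2 * c₀)) =
      c ^ 2 * (if flat then (∑ l, a l * p l) - c₀ else (∑ l, (p l - a l) ^ 2) - c₀) := by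
  cases flat
  · simp only [Bool.false_eq_true, if_false]
    rw [polySimil_sum_round b hA ha p]
    ring
  · simp only [if_true]
    rw [polySimil_sum_flat b hA ha p]
    ring

/-! ### Openness of polytopes -/

/-- A set cut out of the open upper half-space by finitely many strict polynomial inequalities is
open (hence Lebesgue measurable). [folklore] -/
theorem polySimil_isOpen_polytope {n k : ℕ} (flat : Fin k → Bool) (a : Fin k → Fin (n + 1) → ℝ)
    (c₀ ε : Fin k → ℝ) :
    IsOpen {p : Fin (n + 1) → ℝ | 0 < p (Fin.last n) ∧ ∀ i, 0 < ε i *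
      (if flat i then (∑ l, a i l * p l) - c₀ i else (∑ l, (p l - a i l) ^ 2) - c₀ i)} := by
  simp only [Set.setOf_and, Set.setOf_forall]
  refine (isOpen_lt continuous_const (continuous_apply _)).inter
    (isOpen_iInter_of_finite fun i => isOpen_lt continuous_const ?_)
  cases flat i <;> simp only [if_true, Bool.false_eq_true, if_false] <;> fun_prop

/-! ### The stub -/

/-- **Images of polytopes under boundary similarities are polytopes** (stub
`isGeodesicPolytope_image_boundarySimilarity` of line `odd-hyperbolic-ladder`). If `P` is a
finite-volume `ℚ̄`-geodesic polytope of `ℍⁿ⁺¹` and `g : (x, t) ↦ (c • A x + b, c t)` is a boundary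
similarity with `c > 0` algebraic, `A` orthogonal with algebraic entries and `b` algebraic, then
`g '' P` is a finite-volume `ℚ̄`-geodesic polytope: vertical faces go to vertical faces (normal
`(c • A a_x, 0)`, level `c² c₀ + c ⟨A a_x, b⟩`), hemispheres centred on the boundary to hemispheres
centred on the boundary (centre `g (a_x, 0)`, squared radius `c² c₀`), the new data are algebraic,
and the volume is finite by the change of variables `p ↦ g p` (`|det Dg| (c t)^{-(n+1)} = t^{-(n+1)}`).
[cite: BenedettiPetronio1992, A.3.5] -/
theorem isGeodesicPolytope_image_boundarySimilarity : ∀ (n : ℕ) (c : ℝ) (A : Matrix (Fin n) (Fin n) ℝ) (b : Fin n → ℝ), IsAlgebraic ℚ c → 0 < c → (∀ i j, IsAlgebraic ℚ (A i j)) → A.transpose * A = 1 → (∀ i, IsAlgebraic ℚ (b i)) → ∀ P : Set (Fin (n + 1) → ℝ), Literature.NumberTheory.Transcendental.KZ.IsGeodesicPolytope n P → Literature.NumberTheory.Transcendental.KZ.IsGeodesicPolytope n (Literature.NumberTheory.Transcendental.KZ.boundarySimilarity n c A b '' P) := by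
  intro n c A b hc hc0 hA hAA hb P hP
  obtain ⟨k, flat, a, c₀, ε, ha, hc₀, hε, ha0, rfl, hint⟩ := hP
  have hc' : c ≠ 0 := hc0.ne'
  -- the entries of `A a_x` are algebraic
  have hv : ∀ i j, IsAlgebraic ℚ (A.mulVec (Fin.init (a i)) j) := fun i j =>
    polySimil_isAlgebraic_mulVec hA (fun l => ha i _) j
  refine ⟨k, flat,
    fun i => Fin.snoc (α := fun _ => ℝ)
      (if flat i then c • A.mulVec (Fin.init (a i)) else c • A.mulVec (Fin.init (a i)) + b) 0,
    fun i => if flat i then c ^ 2 * c₀ i + c * (A.mulVec (Fin.init (a i)) ⬝ᵥ b) else c ^ 2 * c₀ i,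
    ε, ?_, ?_, hε, ?_, ?_, ?_⟩
  · -- the new normals / centres are algebraic
    intro i l
    induction l using Fin.lastCases with
    | last => simp only [Fin.snoc_last]; exact isAlgebraic_zero
    | cast j =>
      simp only [Fin.snoc_castSucc]
      cases flat i
      · simp only [Bool.false_eq_true, if_false, Pi.add_apply, Pi.smul_apply, smul_eq_mul]
        exact (hc.mul (hv i j)).add (hb j)
      · simp only [if_true, Pi.smul_apply, smul_eq_mul]
        exact hc.mul (hv i j)
  · -- the new levels are algebraic
    intro i
    dsimp only
    cases flat i
    · simp only [Bool.false_eq_true, if_false]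
      exact (hc.pow 2).mul (hc₀ i)
    · simp only [if_true]
      exact ((hc.pow 2).mul (hc₀ i)).add (hc.mul (polySimil_isAlgebraic_dotProduct (hv i) hb))
  · -- the new faces are vertical / centred on the boundary
    intro i
    simp only [Fin.snoc_last]
  · -- the image is cut out by the new constraints
    ext q
    simp only [Set.mem_image, Set.mem_setOf_eq]
    constructor
    · rintro ⟨p, ⟨hp0, hpi⟩, rfl⟩
      refine ⟨?_, fun i => ?_⟩
      · rw [polySimil_apply_last]
        exact mul_pos hc0 hp0
      · rw [polySimil_constraint_apply b hAA (flat i) (ha0 i) (c₀ i) p, mul_left_comm]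
        exact mul_pos (pow_pos hc0 2) (hpi i)
    · rintro ⟨hq0, hqi⟩
      refine ⟨Fin.snoc (α := fun _ => ℝ) (c⁻¹ • A.transpose.mulVec (Fin.init q - b))
        (c⁻¹ * q (Fin.last n)), ⟨?_, fun i => ?_⟩, polySimil_apply_symm_apply b hc' hAA q⟩
      · simp only [Fin.snoc_last]
        exact mul_pos (inv_pos.2 hc0) hq0
      · have h := hqi i
        rw [← polySimil_apply_symm_apply b hc' hAA q,
          polySimil_constraint_apply b hAA (flat i) (ha0 i) (c₀ i), mul_left_comm] at h
        exact pos_of_mul_pos_right h (pow_pos hc0 2).le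
  · -- finite hyperbolic volume: change of variables along `g`
    obtain ⟨L, hL, hLdet⟩ := simil_exists_linearPart n c A
    have hdetA : |A.det| = 1 := by
      have h := congrArg Matrix.det hAA
      rw [Matrix.det_mul, Matrix.det_transpose, Matrix.det_one] at h
      have h' : |A.det| * |A.det| = 1 := by rw [← abs_mul, h, abs_one]
      rcases mul_self_eq_one_iff.mp h' with h'' | h''
      · exact h''
      · exact absurd h'' (by have := abs_nonneg A.det; linarith)
    have hLabs : |L.det| = c ^ (n + 1) := by
      rw [hLdet, abs_mul, hdetA, mul_one, abs_of_pos (pow_pos hc0 _)]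
    have hgL : KZ.boundarySimilarity n c A b = fun p => L p + Fin.snoc (α := fun _ => ℝ) b 0 := by
      funext p
      rw [hL]
      ext i
      induction i using Fin.lastCases with
      | last => simp [KZ.boundarySimilarity]
      | cast i' => simp [KZ.boundarySimilarity]
    have hderiv : ∀ x, HasFDerivAt (KZ.boundarySimilarity n c A b) L x := fun x => by
      rw [hgL]
      exact L.hasFDerivAt.add_const _
    have hinj : Function.Injective (KZ.boundarySimilarity n c A b) := simil_injective b hc' hAA
    have hmeas := (polySimil_isOpen_polytope flat a c₀ ε).measurableSet
    rw [integrableOn_image_iff_integrableOn_abs_det_fderiv_smul volume hmeas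
      (fun x _ => (hderiv x).hasFDerivWithinAt) hinj.injOn]
    refine hint.congr_fun (fun x hx => ?_) hmeas
    simp only [hLabs, smul_eq_mul, KZ.hypDensity, polySimil_apply_last]
    have hx0 : x (Fin.last n) ≠ 0 := ne_of_gt hx.1
    rw [mul_pow]
    field_simp
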